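import Mathlib
import HarnessLib
import Summits.HubbardSuperconductivity.HubbardSuperconductivity.Theorems.KLProgrammeKLRegimeTwoVolumeSrcLawStep
import Summits.HubbardSuperconductivity.HubbardSuperconductivity.Theorems.KLProgrammeKLRegimeEngineTowerBookkeeping

/-!
# Route `KLProgramme` — crux K3, VL child `KLRegimeVolumeLimitV17F3` (stmt-HubbardSuperconductivity-23356), producer route «(VL)-SRC-SOFT» §S3c:
# THE BLOCK STEP IN CLOSED FORM FOR A TWO-SCALE PROFILE — alive per-pair constant `Q`, source per-pair constant `R ≥ Q`, NO amplitude condition,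
# NO per-vertex inflation (generating-function form of the graded sum) (seat hubbard-kl-k3c4-p1 g19; `--supports` 23356)

The source-species step (S2/S3/S3b §1) bounds the block's output by the kit's right side in a BLIND dimensionless input array
`μ = μ_alive + t·μ_src`.  Merging the two into ONE geometric profile (S3b §2 / T2ε) forces a common per-pair constant and charges the quartic chains the factor
`M = max 1 (2ΦA′τQ′)` per extra vertex — which grows with the block length and kills the per-pair reproduction across blocks (located finding F2, memo
SRC-SOFT-g19 §5).  This file is the cure (memo §6, design v2): keep TWO scales in the profile,

  `μ d ≤ λ^{max(1,d−1)}·(C·Q^d + A·R^d) + a·[d = 1]`,  `Q ≤ R`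

(`C, Q`: the alive data — `stub_vl_HE1free`'s law, never fed forward; `A = t·A_s, R`: the source species, fed forward; `a = t·a_s`: the free degree-two source size),
and bound the graded product sum by its GENERATING FUNCTION at `u = (2λτR)⁻¹ ≥ 1` (Gawȩdzki–Kupiainen's trick, as in E1's `towerS_le` but without extracting a
common ratio first):
* §1 **`towerS_le_genFun`** — `towerS D τ μ n p ≤ u^{−(p+n−1)}·(Σ_{d∈[1,D]} τ^d μ(d) u^d)^n` for any `u ≥ 1` (the constraint `Σδ ≥ p+n−1` is traded for `u^{Σδ−(p+n−1)} ≥ 1`;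
  `Finset.sum_pow'`);
* §2 **`genFun_le_twoScale`** — at `u = (2λτR)⁻¹`: `Σ_d τ^d μ(d) u^d ≤ z₀ + z₁/λ`, `z₀ = CQ/(2R) + A/2`, `z₁ = a/(2R) + C(Q/R)² + A` — the alive degree-two mass keeps NO
  `λ⁻¹`, the alive higher degrees are suppressed by `(Q/R)²`, the source ones by `A = t·A_s`;
* §3 `towerV_le_twoScale` (the guard's field norm is `λ`/`a`-small), `towerFO_le_twoScale` (first order, one extra `λ`);
* §4 **`towerStep_le_twoScale`** — under `2λτR ≤ 1`, `4σλR ≤ ½`, `eτλR ≤ ½`, `w := 2ΦτR(λz₀ + z₁) ≤ ½`, `Φ·V_b ≤ ½`: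
  `b ≤ λ^{p−1}·[(C+A)·λ·(4R)^p·8σR + 2e·w·(λz₀+z₁)·(2τψR)^p]` — law shape `λ^{p−1}` with per-pair constant `max(4R, 2τψR)` set by the SOURCE scale `R` alone and an
  amplitude that is SMALL (`λ`, `w`); the smallness rows ask `λ` small AFTER `R`, `R ≥ (const)·ΦτCQ²` (so `w ≤ ½` can hold) and `t` small — all available to a
  β-soft producer (memo §6: then the per-pair constant reproduces across a block of length `d′ ≳ log₂(410·CJ′²·2τ̂ψ̂)` through the recount/units factor).

Pure real analysis; nothing about the model is asserted; nothing asserts any stub, VL, K3 or superconductivity.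
References: BGM 2006 §2.8 (2.83), §2.9 (4.3)–(4.8), §3 (3.2)–(3.8) [cite: BenfattoGiulianiMastropietro2006]; Gawȩdzki–Kupiainen 1985 §3 [cite: GawedzkiKupiainen1985GrossNeveu].
-/

noncomputable section

namespace Summit.HubbardSuperconductivity.HubbardSuperconductivity.Theorems.TwoVolumeDefect

set_option linter.dupNamespace false -- summit = problem name (single-conjunct summit), D-0017

open Real Finset
open Summit.HubbardSuperconductivity.HubbardSuperconductivity.Theorems.EngineV8

/-! ## §1 The graded product sum through its generating function -/

/-- **`towerS` by its generating function**: for `u ≥ 1`, `towerS D τ μ n p ≤ (u⁻¹)^{p+n−1} · (Σ_{d ∈ [1,D]} τ^d μ(d) u^d)^n` (`τ, μ ≥ 0`).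
[cite: GawedzkiKupiainen1985GrossNeveu, §3] -/
theorem towerS_le_genFun {D : ℕ} {τ u : ℝ} {μ : ℕ → ℝ} (hτ : 0 ≤ τ) (hμ0 : ∀ m, 0 ≤ μ m) (hu : 1 ≤ u) (n p : ℕ) :
    towerS D τ μ n p ≤ u⁻¹ ^ (p + n - 1) * (∑ d ∈ Icc 1 D, τ ^ d * μ d * u ^ d) ^ n := by
  have hu0 : 0 < u := lt_of_lt_of_le one_pos hu
  have hui0 : 0 ≤ u⁻¹ := inv_nonneg.2 hu0.le
  have hui1 : u⁻¹ ≤ 1 := inv_le_one_of_one_le₀ hu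
  unfold towerS
  -- termwise: on the constraint set, `Π τ^δ μ(δ) ≤ u^{-(p+n-1)} Π (τ^δ μ(δ) u^δ)`
  have hterm : ∀ δ ∈ (Fintype.piFinset fun _ : Fin n => Icc 1 D).filter (fun δ => p + n - 1 ≤ ∑ a, δ a),
      ∏ a, τ ^ (δ a) * μ (δ a) ≤ u⁻¹ ^ (p + n - 1) * ∏ a, (τ ^ (δ a) * μ (δ a) * u ^ (δ a)) := by
    intro δ hδ
    have hP : p + n - 1 ≤ ∑ a, δ a := (mem_filter.1 hδ).2
    have hx : 0 ≤ ∏ a, τ ^ (δ a) * μ (δ a) := prod_nonneg fun a _ => mul_nonneg (pow_nonneg hτ _) (hμ0 _)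
    have hsplit : ∏ a, (τ ^ (δ a) * μ (δ a) * u ^ (δ a)) = (∏ a, τ ^ (δ a) * μ (δ a)) * u ^ (∑ a, δ a) := by
      rw [prod_mul_distrib, prod_pow_eq_pow_sum]
    rw [hsplit]
    have hupow : u ^ (∑ a, δ a) * u⁻¹ ^ (∑ a, δ a) = 1 := by
      rw [← mul_pow, mul_inv_cancel₀ hu0.ne', one_pow]
    calc ∏ a, τ ^ (δ a) * μ (δ a) = u⁻¹ ^ (∑ a, δ a) * ((∏ a, τ ^ (δ a) * μ (δ a)) * u ^ (∑ a, δ a)) := by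
          calc ∏ a, τ ^ (δ a) * μ (δ a) = (∏ a, τ ^ (δ a) * μ (δ a)) * (u ^ (∑ a, δ a) * u⁻¹ ^ (∑ a, δ a)) := by
                rw [hupow, mul_one]
            _ = u⁻¹ ^ (∑ a, δ a) * ((∏ a, τ ^ (δ a) * μ (δ a)) * u ^ (∑ a, δ a)) := by ring
      _ ≤ u⁻¹ ^ (p + n - 1) * ((∏ a, τ ^ (δ a) * μ (δ a)) * u ^ (∑ a, δ a)) :=
          mul_le_mul_of_nonneg_right (pow_le_pow_of_le_one hui0 hui1 hP) (mul_nonneg hx (pow_nonneg hu0.le _))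
  refine (sum_le_sum hterm).trans ?_
  refine (sum_le_sum_of_subset_of_nonneg (filter_subset _ _) fun δ _ _ =>
    mul_nonneg (pow_nonneg hui0 _) (prod_nonneg fun a _ => mul_nonneg (mul_nonneg (pow_nonneg hτ _) (hμ0 _)) (pow_nonneg hu0.le _))).trans ?_
  rw [← mul_sum, Finset.sum_pow']

/-! ## §2 The generating function of a two-scale profile at `u = (2λτR)⁻¹` -/

/-- `Σ_{d ∈ Ioc 1 D} (1/2)^d ≤ 1`. -/
theorem sum_Ioc_one_half_pow_le_one (D : ℕ) : ∑ d ∈ Ioc 1 D, (1 / 2 : ℝ) ^ d ≤ 1 :=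
  (sum_le_sum_of_subset_of_nonneg (fun d hd => by rw [mem_Ioc] at hd; rw [mem_Icc]; omega) fun d _ _ => by positivity).trans
    (sum_Icc_half_pow_le_one D)

/-- **The generating function of a two-scale profile** at `u = (2λτR)⁻¹`: if `μ d ≤ λ^{max(1,d−1)}(C Q^d + A R^d) + a·[d=1]` on `[1, D]` with `0 ≤ Q ≤ R`,
`0 < λ, τ, R`, then `Σ_{d∈[1,D]} τ^d μ(d) u^d ≤ (CQ/(2R) + A/2) + (a/(2R) + C(Q/R)² + A)/λ`. [cite: GawedzkiKupiainen1985GrossNeveu, §3] -/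
theorem genFun_le_twoScale {D : ℕ} {τ lam Q R C A a : ℝ} {μ : ℕ → ℝ} (hτ : 0 < τ) (hlam : 0 < lam) (hR : 0 < R) (hQ : 0 ≤ Q) (hQR : Q ≤ R)
    (hC : 0 ≤ C) (hA : 0 ≤ A) (ha : 0 ≤ a) (hμ0 : ∀ m, 0 ≤ μ m)
    (hprof : ∀ d, 1 ≤ d → d ≤ D → μ d ≤ lam ^ max 1 (d - 1) * (C * Q ^ d + A * R ^ d) + (if d = 1 then a else 0)) :
    ∑ d ∈ Icc 1 D, τ ^ d * μ d * (2 * lam * τ * R)⁻¹ ^ d ≤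
      (C * Q / (2 * R) + A / 2) + (a / (2 * R) + C * (Q / R) ^ 2 + A) / lam := by
  set u : ℝ := (2 * lam * τ * R)⁻¹ with hudef
  have hu0 : 0 < u := by positivity
  have hτu : τ * u = (2 * lam * R)⁻¹ := by rw [hudef]; field_simp
  have hQR1 : Q / R ≤ 1 := (div_le_one hR).2 hQR
  have hQR0 : 0 ≤ Q / R := div_nonneg hQ hR.le
  by_cases hD : D = 0
  · subst hD
    rw [show Icc 1 0 = (∅ : Finset ℕ) by rfl, sum_empty]
    positivity
  have hD1 : 1 ≤ D := Nat.one_le_iff_ne_zero.2 hD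
  have hsplit : Icc 1 D = insert 1 (Ioc 1 D) := by ext m; simp only [mem_Icc, mem_insert, mem_Ioc]; omega
  have hnot : (1 : ℕ) ∉ Ioc 1 D := by simp
  rw [hsplit, sum_insert hnot]
  -- degree two
  have h1 : τ ^ 1 * μ 1 * u ^ 1 ≤ C * Q / (2 * R) + A / 2 + a / (2 * R) / lam := by
    have hμ := hprof 1 le_rfl hD1
    have hmax : max 1 (1 - 1) = 1 := by norm_num
    rw [hmax, if_pos rfl, pow_one, pow_one, pow_one] at hμ
    rw [pow_one, pow_one]
    have hμ0' := hμ0 1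
    calc τ * μ 1 * u = (τ * u) * μ 1 := by ring
      _ ≤ (τ * u) * (lam * (C * Q + A * R) + a) := mul_le_mul_of_nonneg_left hμ (by positivity)
      _ = C * Q / (2 * R) + A / 2 + a / (2 * R) / lam := by rw [hτu]; field_simp
  -- higher degrees: `(C (Q/R)² + A)/λ · (1/2)^d`
  have hterm : ∀ d ∈ Ioc 1 D, τ ^ d * μ d * u ^ d ≤ (C * (Q / R) ^ 2 + A) / lam * (1 / 2 : ℝ) ^ d := by
    intro d hd
    rw [mem_Ioc] at hd
    have hμ := hprof d (by omega) hd.2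
    have hmax : max 1 (d - 1) = d - 1 := max_eq_right (by omega)
    rw [hmax, if_neg (by omega), add_zero] at hμ
    have hμ0' := hμ0 d
    obtain ⟨j, rfl⟩ : ∃ j, d = j + 2 := ⟨d - 2, by omega⟩
    have hpow : (τ * u) ^ (j + 2) = ((2 * lam * R)⁻¹) ^ (j + 2) := by rw [hτu]
    -- `(Q/(2R))^{j+2} ≤ (Q/R)²·(1/2)^{j+2}` and `(1/2)^{j+2}` for the source part
    have hQpow : Q ^ (j + 2) * ((2 * lam * R)⁻¹) ^ (j + 2) = (Q / R) ^ (j + 2) * (1 / 2) ^ (j + 2) * lam⁻¹ ^ (j + 2) := by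
      rw [← mul_pow, ← mul_pow, ← mul_pow]; congr 1; field_simp
    have hRpow : R ^ (j + 2) * ((2 * lam * R)⁻¹) ^ (j + 2) = (1 / 2 : ℝ) ^ (j + 2) * lam⁻¹ ^ (j + 2) := by
      rw [← mul_pow, ← mul_pow]; congr 1; field_simp
    have hl1 : lam⁻¹ ^ (j + 2) * lam ^ (j + 2 - 1) = lam⁻¹ := by
      rw [show j + 2 - 1 = j + 1 by omega, pow_succ (lam⁻¹) (j + 1)]
      have h1 : lam⁻¹ ^ (j + 1) * lam ^ (j + 1) = 1 := by rw [← mul_pow, inv_mul_cancel₀ hlam.ne', one_pow]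
      calc lam⁻¹ ^ (j + 1) * lam⁻¹ * lam ^ (j + 1) = lam⁻¹ * (lam⁻¹ ^ (j + 1) * lam ^ (j + 1)) := by ring
        _ = lam⁻¹ := by rw [h1, mul_one]
    have hQj : (Q / R) ^ (j + 2) ≤ (Q / R) ^ 2 := pow_le_pow_of_le_one hQR0 hQR1 (by omega)
    calc τ ^ (j + 2) * μ (j + 2) * u ^ (j + 2)
        = (τ * u) ^ (j + 2) * μ (j + 2) := by rw [mul_pow]; ring
      _ ≤ (τ * u) ^ (j + 2) * (lam ^ (j + 2 - 1) * (C * Q ^ (j + 2) + A * R ^ (j + 2))) :=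
          mul_le_mul_of_nonneg_left hμ (by positivity)
      _ = lam⁻¹ ^ (j + 2) * lam ^ (j + 2 - 1) * (C * ((Q / R) ^ (j + 2) * (1 / 2) ^ (j + 2)) + A * (1 / 2) ^ (j + 2)) := by
          rw [hpow]
          have e1 : ((2 * lam * R)⁻¹) ^ (j + 2) * (lam ^ (j + 2 - 1) * (C * Q ^ (j + 2) + A * R ^ (j + 2))) =
              lam ^ (j + 2 - 1) * (C * (Q ^ (j + 2) * ((2 * lam * R)⁻¹) ^ (j + 2)) + A * (R ^ (j + 2) * ((2 * lam * R)⁻¹) ^ (j + 2))) := by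
            ring
          rw [e1, hQpow, hRpow]; ring
      _ = lam⁻¹ * (1 / 2) ^ (j + 2) * (C * (Q / R) ^ (j + 2) + A) := by rw [hl1]; ring
      _ ≤ lam⁻¹ * (1 / 2) ^ (j + 2) * (C * (Q / R) ^ 2 + A) := by gcongr
      _ = (C * (Q / R) ^ 2 + A) / lam * (1 / 2) ^ (j + 2) := by rw [div_eq_mul_inv]; ring
  have hsum : ∑ d ∈ Ioc 1 D, τ ^ d * μ d * u ^ d ≤ (C * (Q / R) ^ 2 + A) / lam := by
    refine (sum_le_sum hterm).trans ?_
    rw [← mul_sum]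
    exact (mul_le_mul_of_nonneg_left (sum_Ioc_one_half_pow_le_one D) (by positivity)).trans (le_of_eq (mul_one _))
  calc τ ^ 1 * μ 1 * u ^ 1 + ∑ d ∈ Ioc 1 D, τ ^ d * μ d * u ^ d
      ≤ (C * Q / (2 * R) + A / 2 + a / (2 * R) / lam) + (C * (Q / R) ^ 2 + A) / lam := add_le_add h1 hsum
    _ = (C * Q / (2 * R) + A / 2) + (a / (2 * R) + C * (Q / R) ^ 2 + A) / lam := by ring

/-! ## §3 The field norm and the first order of a two-scale profile -/

/-- **The field-weighted norm of a two-scale profile** (`eτλR ≤ ½`): `towerV ≤ eτ·(λ(CQ+AR) + a) + 2λ·(eτ)²·(CQ² + AR²)·2`. -/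
theorem towerV_le_twoScale {D : ℕ} {τ lam Q R C A a : ℝ} {μ : ℕ → ℝ} (hτ : 0 ≤ τ) (hlam : 0 ≤ lam) (hR : 0 ≤ R) (hQ : 0 ≤ Q) (hQR : Q ≤ R)
    (hC : 0 ≤ C) (hA : 0 ≤ A) (ha : 0 ≤ a) (hμ0 : ∀ m, 0 ≤ μ m)
    (hprof : ∀ d, 1 ≤ d → d ≤ D → μ d ≤ lam ^ max 1 (d - 1) * (C * Q ^ d + A * R ^ d) + (if d = 1 then a else 0))
    (hx₃ : exp 1 * τ * lam * R ≤ 1 / 2) :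
    towerV D τ μ ≤ exp 1 * τ * (lam * (C * Q + A * R) + a) + 4 * lam * (exp 1 * τ) ^ 2 * (C * Q ^ 2 + A * R ^ 2) := by
  unfold towerV
  by_cases hD : D = 0
  · subst hD
    rw [show Icc 1 0 = (∅ : Finset ℕ) by rfl, sum_empty]
    positivity
  have hD1 : 1 ≤ D := Nat.one_le_iff_ne_zero.2 hD
  have hsplit : Icc 1 D = insert 1 (Ioc 1 D) := by ext m; simp only [mem_Icc, mem_insert, mem_Ioc]; omega
  have hnot : (1 : ℕ) ∉ Ioc 1 D := by simp
  rw [hsplit, sum_insert hnot]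
  have h1 : (exp 1 * τ) ^ 1 * μ 1 ≤ exp 1 * τ * (lam * (C * Q + A * R) + a) := by
    have hμ := hprof 1 le_rfl hD1
    have hmax : max 1 (1 - 1) = 1 := by norm_num
    rw [hmax, if_pos rfl, pow_one, pow_one, pow_one] at hμ
    rw [pow_one]
    exact mul_le_mul_of_nonneg_left hμ (by positivity)
  have hxQ : exp 1 * τ * lam * Q ≤ 1 / 2 := (mul_le_mul_of_nonneg_left hQR (by positivity)).trans hx₃
  have hterm : ∀ d ∈ Ioc 1 D, (exp 1 * τ) ^ d * μ d ≤ lam * (exp 1 * τ) ^ 2 * (C * Q ^ 2 + A * R ^ 2) * (1 / 2 : ℝ) ^ (d - 2) := by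
    intro d hd
    rw [mem_Ioc] at hd
    have hμ := hprof d (by omega) hd.2
    have hmax : max 1 (d - 1) = d - 1 := max_eq_right (by omega)
    rw [hmax, if_neg (by omega), add_zero] at hμ
    have hμ0' := hμ0 d
    obtain ⟨j, rfl⟩ : ∃ j, d = j + 2 := ⟨d - 2, by omega⟩
    simp only [Nat.add_sub_cancel, show j + 2 - 1 = j + 1 by omega] at hμ ⊢
    -- `(eτ)^{j+2} λ^{j+1} X^{j+2} = λ (eτ)² X² · (eτλX)^j ≤ λ(eτ)²X² (1/2)^j`
    have hX : ∀ X : ℝ, 0 ≤ X → exp 1 * τ * lam * X ≤ 1 / 2 →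
        (exp 1 * τ) ^ (j + 2) * (lam ^ (j + 1) * X ^ (j + 2)) ≤ lam * (exp 1 * τ) ^ 2 * X ^ 2 * (1 / 2 : ℝ) ^ j := by
      intro X hX0 hXs
      have hpw : (exp 1 * τ * lam * X) ^ j ≤ (1 / 2 : ℝ) ^ j := pow_le_pow_left₀ (by positivity) hXs j
      calc (exp 1 * τ) ^ (j + 2) * (lam ^ (j + 1) * X ^ (j + 2)) = lam * (exp 1 * τ) ^ 2 * X ^ 2 * (exp 1 * τ * lam * X) ^ j := by ring
        _ ≤ lam * (exp 1 * τ) ^ 2 * X ^ 2 * (1 / 2 : ℝ) ^ j := mul_le_mul_of_nonneg_left hpw (by positivity)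
    calc (exp 1 * τ) ^ (j + 2) * μ (j + 2) ≤ (exp 1 * τ) ^ (j + 2) * (lam ^ (j + 1) * (C * Q ^ (j + 2) + A * R ^ (j + 2))) :=
          mul_le_mul_of_nonneg_left hμ (by positivity)
      _ = C * ((exp 1 * τ) ^ (j + 2) * (lam ^ (j + 1) * Q ^ (j + 2))) + A * ((exp 1 * τ) ^ (j + 2) * (lam ^ (j + 1) * R ^ (j + 2))) := by ring
      _ ≤ C * (lam * (exp 1 * τ) ^ 2 * Q ^ 2 * (1 / 2 : ℝ) ^ j) + A * (lam * (exp 1 * τ) ^ 2 * R ^ 2 * (1 / 2 : ℝ) ^ j) :=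
          add_le_add (mul_le_mul_of_nonneg_left (hX Q hQ hxQ) hC) (mul_le_mul_of_nonneg_left (hX R hR hx₃) hA)
      _ = lam * (exp 1 * τ) ^ 2 * (C * Q ^ 2 + A * R ^ 2) * (1 / 2 : ℝ) ^ j := by ring
  have hsum : ∑ d ∈ Ioc 1 D, (exp 1 * τ) ^ d * μ d ≤ lam * (exp 1 * τ) ^ 2 * (C * Q ^ 2 + A * R ^ 2) * 2 := by
    refine (sum_le_sum hterm).trans ?_
    rw [← mul_sum]
    refine mul_le_mul_of_nonneg_left ?_ (by positivity)
    have h := sum_Ioc_one_pow_sub_two_le (x := (1 / 2 : ℝ)) (by norm_num) (by norm_num) D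
    exact h.trans (by norm_num)
  calc (exp 1 * τ) ^ 1 * μ 1 + ∑ d ∈ Ioc 1 D, (exp 1 * τ) ^ d * μ d
      ≤ exp 1 * τ * (lam * (C * Q + A * R) + a) + lam * (exp 1 * τ) ^ 2 * (C * Q ^ 2 + A * R ^ 2) * 2 := add_le_add h1 hsum
    _ ≤ exp 1 * τ * (lam * (C * Q + A * R) + a) + 4 * lam * (exp 1 * τ) ^ 2 * (C * Q ^ 2 + A * R ^ 2) := by
        have : 0 ≤ lam * (exp 1 * τ) ^ 2 * (C * Q ^ 2 + A * R ^ 2) := by positivity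
        nlinarith

/-- **The first order of a two-scale profile** (`4σλR ≤ ½`, `1 ≤ p`): `towerFO ≤ (C+A)·λ^p·(4R)^p·8σR` — one extra `λ` (at least one contraction). -/
theorem towerFO_le_twoScale {D : ℕ} {σ lam Q R C A a : ℝ} {μ : ℕ → ℝ} (hσ : 0 ≤ σ) (hlam : 0 ≤ lam) (hR : 0 ≤ R)
    (hQ : 0 ≤ Q) (hQR : Q ≤ R) (hC : 0 ≤ C) (hA : 0 ≤ A) (hμ0 : ∀ m, 0 ≤ μ m)
    (hprof : ∀ d, 1 ≤ d → d ≤ D → μ d ≤ lam ^ max 1 (d - 1) * (C * Q ^ d + A * R ^ d) + (if d = 1 then a else 0))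
    (hx₁ : 4 * σ * lam * R ≤ 1 / 2) {p : ℕ} (hp : 1 ≤ p) :
    towerFO D σ μ p ≤ (C + A) * lam ^ p * ((4 * R) ^ p * (8 * σ * R)) := by
  -- the array without its degree-two entry obeys the one-scale profile `(C+A) λ^{m−1} R^m`
  set μ' : ℕ → ℝ := fun m => if m = 1 then 0 else μ m with hμ'
  have hμ'0 : ∀ m, 0 ≤ μ' m := fun m => by simp only [hμ']; split_ifs; exacts [le_rfl, hμ0 m]
  have hprof' : ∀ m, 1 ≤ m → m ≤ D → μ' m ≤ (C + A) * lam ^ (m - 1) * R ^ m := by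
    intro m hm hmD
    simp only [hμ']
    split_ifs with h1
    · positivity
    · have hμ := hprof m hm hmD
      have hmax : max 1 (m - 1) = m - 1 := max_eq_right (by omega)
      rw [hmax, if_neg h1, add_zero] at hμ
      refine hμ.trans ?_
      have hQm : Q ^ m ≤ R ^ m := pow_le_pow_left₀ hQ hQR m
      have hl : 0 ≤ lam ^ (m - 1) := pow_nonneg hlam _
      nlinarith [mul_nonneg hC (sub_nonneg.2 hQm), mul_nonneg hl (mul_nonneg hC (sub_nonneg.2 hQm))]
  have hFO' : towerFO D σ μ p = towerFO D σ μ' p := by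
    unfold towerFO
    refine sum_congr rfl fun m hm => ?_
    rw [mem_Ioc] at hm
    simp only [hμ', if_neg (show m ≠ 1 by omega)]
  have hx₁lt : 4 * σ * lam * R < 1 := by linarith
  have h := towerFO_le hσ (by positivity : 0 ≤ C + A) hlam hR hμ'0 hprof' hx₁lt hp (D := D)
  rw [hFO']
  refine h.trans ?_
  have hfrac : 4 * σ * lam * R / (1 - 4 * σ * lam * R) ≤ lam * (8 * σ * R) := by
    rw [div_le_iff₀ (by linarith)]
    have h12 : (1 : ℝ) / 2 ≤ 1 - 4 * σ * lam * R := by linarith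
    calc 4 * σ * lam * R = (lam * (8 * σ * R)) * (1 / 2) := by ring
      _ ≤ (lam * (8 * σ * R)) * (1 - 4 * σ * lam * R) := mul_le_mul_of_nonneg_left h12 (by positivity)
  calc (C + A) * lam ^ (p - 1) * (4 * R) ^ p * (4 * σ * lam * R / (1 - 4 * σ * lam * R))
      ≤ (C + A) * lam ^ (p - 1) * (4 * R) ^ p * (lam * (8 * σ * R)) := by gcongr
    _ = (C + A) * (lam ^ (p - 1) * lam) * ((4 * R) ^ p * (8 * σ * R)) := by ring
    _ = (C + A) * lam ^ p * ((4 * R) ^ p * (8 * σ * R)) := by rw [← pow_succ, Nat.sub_add_cancel hp]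

/-! ## §4 The block step in closed form for a two-scale profile -/

/-- **(T2₂) THE BLOCK STEP FOR A TWO-SCALE PROFILE, IN CLOSED FORM — no amplitude condition, no per-vertex inflation.**
Inputs `0 ≤ μ d ≤ λ^{max(1,d−1)}(CQ^d + AR^d) + a[d=1]` on `[1,D]` (`0 ≤ Q ≤ R`, `0 < λ`, `0 < τ`, `0 < R`); the kit's step hypothesis for `b` in half-degree
`p ≥ 1` for every cumulant order `N ≥ 2` under the guard `Φ·V < 1`; the rows `2λτR ≤ 1`, `4σλR ≤ ½`, `eτλR ≤ ½`, `w := 2ΦτR(λz₀+z₁) ≤ ½`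
(`z₀ = CQ/(2R) + A/2`, `z₁ = a/(2R) + C(Q/R)² + A`) and `Φ·V_b ≤ ½` (`V_b` the bound of `towerV_le_twoScale`).  Then
`b ≤ λ^{p−1}·[(C+A)·λ·(4R)^p·8σR + 2e·w·(λz₀+z₁)·(2τψR)^p]`. [cite: BenfattoGiulianiMastropietro2006, §2.8 (2.83); cite: GawedzkiKupiainen1985GrossNeveu, §3] -/
theorem towerStep_le_twoScale {D : ℕ} {μ : ℕ → ℝ} {b σ Φ ψ τ lam Q R C A a : ℝ}
    (hσ : 0 ≤ σ) (hΦ : 0 ≤ Φ) (hψ : 0 ≤ ψ) (hτ : 0 < τ) (hlam : 0 < lam) (hR : 0 < R) (hQ : 0 ≤ Q) (hQR : Q ≤ R)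
    (hC : 0 ≤ C) (hA : 0 ≤ A) (ha : 0 ≤ a) (hμ0 : ∀ m, 0 ≤ μ m)
    (hprof : ∀ d, 1 ≤ d → d ≤ D → μ d ≤ lam ^ max 1 (d - 1) * (C * Q ^ d + A * R ^ d) + (if d = 1 then a else 0))
    (hx₂ : 2 * lam * τ * R ≤ 1) (hx₁ : 4 * σ * lam * R ≤ 1 / 2) (hx₃ : exp 1 * τ * lam * R ≤ 1 / 2)
    (hw : Φ * (2 * τ * R * (lam * (C * Q / (2 * R) + A / 2) + (a / (2 * R) + C * (Q / R) ^ 2 + A))) ≤ 1 / 2)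
    (hV : Φ * (exp 1 * τ * (lam * (C * Q + A * R) + a) + 4 * lam * (exp 1 * τ) ^ 2 * (C * Q ^ 2 + A * R ^ 2)) ≤ 1 / 2)
    {p : ℕ} (hp : 1 ≤ p)
    (hstep : ∀ N : ℕ, 2 ≤ N → Φ * towerV D τ μ < 1 →
      b ≤ towerFO D σ μ p + ∑ n ∈ Icc 2 N, exp 1 * Φ ^ (n - 1) * ψ ^ p * towerS D τ μ n p +
        ψ ^ p * exp 1 * towerV D τ μ * (Φ * towerV D τ μ) ^ N / (1 - Φ * towerV D τ μ)) :
    b ≤ lam ^ (p - 1) * ((C + A) * lam * ((4 * R) ^ p * (8 * σ * R)) +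
      2 * exp 1 * (Φ * (2 * τ * R * (lam * (C * Q / (2 * R) + A / 2) + (a / (2 * R) + C * (Q / R) ^ 2 + A)))) *
        (lam * (C * Q / (2 * R) + A / 2) + (a / (2 * R) + C * (Q / R) ^ 2 + A)) * (2 * τ * ψ * R) ^ p) := by
  -- abbreviations
  set z₀ : ℝ := C * Q / (2 * R) + A / 2 with hz₀
  set z₁ : ℝ := a / (2 * R) + C * (Q / R) ^ 2 + A with hz₁
  set ζ : ℝ := lam * z₀ + z₁ with hζ
  set w : ℝ := Φ * (2 * τ * R * ζ) with hwdef
  have hz₀0 : 0 ≤ z₀ := by positivity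
  have hz₁0 : 0 ≤ z₁ := by positivity
  have hζ0 : 0 ≤ ζ := by positivity
  have hw0 : 0 ≤ w := by positivity
  have hwlt : w < 1 := by linarith
  set u : ℝ := (2 * lam * τ * R)⁻¹ with hudef
  have h2 : 0 < 2 * lam * τ * R := by positivity
  have hu1 : 1 ≤ u := by rw [hudef]; exact (one_le_inv₀ h2).2 hx₂
  -- the generating function and the graded sum
  set Z : ℝ := ∑ d ∈ Icc 1 D, τ ^ d * μ d * u ^ d with hZdef
  have hZ0 : 0 ≤ Z := sum_nonneg fun d _ => by have := hμ0 d; positivity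
  have hZle : Z ≤ z₀ + z₁ / lam := genFun_le_twoScale hτ hlam hR hQ hQR hC hA ha hμ0 hprof
  have hlamZ : lam * Z ≤ ζ := by
    have h := mul_le_mul_of_nonneg_left hZle hlam.le
    rwa [mul_add, mul_div_cancel₀ _ hlam.ne'] at h
  -- `u⁻¹ = 2λτR`
  have huinv : u⁻¹ = 2 * lam * τ * R := by rw [hudef, inv_inv]
  have hS : ∀ n, towerS D τ μ n p ≤ (2 * lam * τ * R) ^ (p + n - 1) * Z ^ n := fun n => by
    have h := towerS_le_genFun hτ.le hμ0 hu1 n p (D := D)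
    rwa [huinv] at h
  -- graded partial sums: `Σ_{n∈Icc 2 N} eΦ^{n−1}ψ^p S_n ≤ e (2τψR)^p λ^{p−1} ζ · w/(1−w) ≤ 2 e w ζ (2τψR)^p λ^{p−1}`
  have hG : ∀ N, ∑ n ∈ Icc 2 N, exp 1 * Φ ^ (n - 1) * ψ ^ p * towerS D τ μ n p ≤
      lam ^ (p - 1) * (2 * exp 1 * w * ζ * (2 * τ * ψ * R) ^ p) := by
    intro N
    have hterm : ∀ n ∈ Icc 2 N, exp 1 * Φ ^ (n - 1) * ψ ^ p * towerS D τ μ n p ≤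
        exp 1 * (2 * τ * ψ * R) ^ p * lam ^ (p - 1) * ζ * w ^ (n - 1) := by
      intro n hn
      have hn2 : 2 ≤ n := (mem_Icc.1 hn).1
      have hS0 := towerS_nonneg hτ.le hμ0 n p (D := D)
      calc exp 1 * Φ ^ (n - 1) * ψ ^ p * towerS D τ μ n p
          ≤ exp 1 * Φ ^ (n - 1) * ψ ^ p * ((2 * lam * τ * R) ^ (p + n - 1) * Z ^ n) := by gcongr; exact hS n
        _ = exp 1 * (2 * τ * ψ * R) ^ p * lam ^ (p - 1) * (lam * Z) * (Φ * (2 * τ * R * (lam * Z))) ^ (n - 1) := by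
            obtain ⟨j, rfl⟩ : ∃ j, n = j + 1 := ⟨n - 1, by omega⟩
            obtain ⟨q, rfl⟩ : ∃ q, p = q + 1 := ⟨p - 1, by omega⟩
            simp only [Nat.add_sub_cancel, show q + 1 + (j + 1) - 1 = (q + 1) + j by omega]
            ring
        _ ≤ exp 1 * (2 * τ * ψ * R) ^ p * lam ^ (p - 1) * ζ * w ^ (n - 1) := by
            have h1 : Φ * (2 * τ * R * (lam * Z)) ≤ w := by rw [hwdef]; gcongr
            have h1' : (Φ * (2 * τ * R * (lam * Z))) ^ (n - 1) ≤ w ^ (n - 1) := pow_le_pow_left₀ (by positivity) h1 _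
            have hlz : 0 ≤ lam * Z := by positivity
            gcongr
    refine (sum_le_sum hterm).trans ?_
    rw [← mul_sum]
    have hgeo : ∑ n ∈ Icc 2 N, w ^ (n - 1) ≤ w / (1 - w) := sum_Icc_two_pow_sub_one_le hw0 hwlt N
    have h2w : w / (1 - w) ≤ 2 * w := by
      rw [div_le_iff₀ (by linarith)]; nlinarith
    calc exp 1 * (2 * τ * ψ * R) ^ p * lam ^ (p - 1) * ζ * ∑ n ∈ Icc 2 N, w ^ (n - 1)
        ≤ exp 1 * (2 * τ * ψ * R) ^ p * lam ^ (p - 1) * ζ * (2 * w) :=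
          mul_le_mul_of_nonneg_left (hgeo.trans h2w) (by positivity)
      _ = lam ^ (p - 1) * (2 * exp 1 * w * ζ * (2 * τ * ψ * R) ^ p) := by ring
  -- first order
  have hFO : towerFO D σ μ p ≤ lam ^ (p - 1) * ((C + A) * lam * ((4 * R) ^ p * (8 * σ * R))) := by
    have h := towerFO_le_twoScale hσ hlam.le hR.le hQ hQR hC hA hμ0 hprof hx₁ hp (D := D)
    refine h.trans (le_of_eq ?_)
    rw [show lam ^ p = lam ^ (p - 1) * lam by rw [← pow_succ, Nat.sub_add_cancel hp]]
    ring
  -- the guard and the tail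
  set V := towerV D τ μ with hVdef
  set Vb : ℝ := exp 1 * τ * (lam * (C * Q + A * R) + a) + 4 * lam * (exp 1 * τ) ^ 2 * (C * Q ^ 2 + A * R ^ 2) with hVb
  have hV0 : 0 ≤ V := towerV_nonneg hτ.le hμ0
  have hVle : V ≤ Vb := towerV_le_twoScale hτ.le hlam.le hR.le hQ hQR hC hA ha hμ0 hprof hx₃
  have hθ0 : 0 ≤ Φ * V := mul_nonneg hΦ hV0
  have hθb : Φ * V ≤ Φ * Vb := mul_le_mul_of_nonneg_left hVle hΦ
  have hθ1 : Φ * V < 1 := by linarith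
  have hθb0 : 0 ≤ Φ * Vb := hθ0.trans hθb
  have hθblt : Φ * Vb < 1 := by linarith
  set T : ℕ → ℝ := fun N => ψ ^ p * exp 1 * Vb * (Φ * Vb) ^ N / (1 - Φ * Vb) with hT
  have hVb0 : 0 ≤ Vb := hV0.trans hVle
  have hψe : 0 ≤ ψ ^ p * exp 1 := mul_nonneg (pow_nonneg hψ _) (exp_pos 1).le
  have hTail : ∀ N, ψ ^ p * exp 1 * V * (Φ * V) ^ N / (1 - Φ * V) ≤ T N := by
    intro N
    have h1 : 0 < 1 - Φ * Vb := by linarith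
    have h2' : 1 - Φ * Vb ≤ 1 - Φ * V := sub_le_sub_left hθb 1
    rw [hT]
    dsimp only
    rw [div_eq_mul_inv, div_eq_mul_inv]
    have hinv : (1 - Φ * V)⁻¹ ≤ (1 - Φ * Vb)⁻¹ := inv_anti₀ h1 h2'
    have hinv0 : 0 ≤ (1 - Φ * V)⁻¹ := inv_nonneg.2 (sub_nonneg.2 hθ1.le)
    have hpowN : (Φ * V) ^ N ≤ (Φ * Vb) ^ N := pow_le_pow_left₀ hθ0 hθb N
    have ha' : ψ ^ p * exp 1 * V ≤ ψ ^ p * exp 1 * Vb := mul_le_mul_of_nonneg_left hVle hψe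
    have hb' : ψ ^ p * exp 1 * V * (Φ * V) ^ N ≤ ψ ^ p * exp 1 * Vb * (Φ * Vb) ^ N :=
      mul_le_mul ha' hpowN (pow_nonneg hθ0 _) (mul_nonneg hψe hVb0)
    exact mul_le_mul hb' hinv hinv0 (mul_nonneg (mul_nonneg hψe hVb0) (pow_nonneg hθb0 _))
  set Main : ℝ := lam ^ (p - 1) * ((C + A) * lam * ((4 * R) ^ p * (8 * σ * R))) +
    lam ^ (p - 1) * (2 * exp 1 * w * ζ * (2 * τ * ψ * R) ^ p) with hMain
  have hbN : ∀ N, 2 ≤ N → b ≤ Main + T N := fun N hN => by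
    have h := hstep N hN hθ1
    have := add_le_add_three hFO (hG N) (hTail N)
    linarith
  have hTto : Filter.Tendsto T Filter.atTop (nhds 0) := by
    have h := (tendsto_pow_atTop_nhds_zero_of_lt_one hθb0 hθblt).mul_const ((1 - Φ * Vb)⁻¹) |>.const_mul (ψ ^ p * exp 1 * Vb)
    rw [zero_mul, mul_zero] at h
    refine h.congr' (Filter.Eventually.of_forall fun N => ?_)
    rw [hT]
    dsimp only
    rw [div_eq_mul_inv]
    ring
  have hlim : Filter.Tendsto (fun N => Main + T N) Filter.atTop (nhds Main) := by
    have := hTto.const_add Main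
    rwa [add_zero] at this
  have hble : b ≤ Main := ge_of_tendsto hlim (Filter.eventually_atTop.2 ⟨2, fun N hN => hbN N hN⟩)
  refine hble.trans (le_of_eq ?_)
  rw [hMain]
  ring

end Summit.HubbardSuperconductivity.HubbardSuperconductivity.Theorems.TwoVolumeDefect

end
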